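import Mathlib.Topology.Homotopy.Affine
import Mathlib.Analysis.SpecialFunctions.Trigonometric.Basic
import HarnessLib

/-!
# The boundary of the unit square is homotopic to a small circle, avoiding the Gaussian integers

Topic `Literature/AlgebraicTopology/FundamentalGroup` (planar infrastructure, proof-only: THEOREMS ONLY,
no definitions).  The classical picture behind "`π₁(T²) = ⟨a, b ∣ aba⁻¹b⁻¹⟩`: the boundary of the
square is the commutator" (A. Hatcher, *Algebraic Topology*, CUP 2002, §1.2 p. 51) read in the
universal cover `ℂ → ℂ/ℤ[i]` of the torus PUNCTURED at the origin: the boundary loop `L` of the unit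
square with lower-left corner `b = s·e^{5πi/4}` (`0 < s < 1/2`; the square then contains exactly one
Gaussian integer, `0`, in its interior) and the circle `C(t) = s·e^{i(5π/4 + 2πt)}` about `0` through
`b` are homotopic (rel. endpoints) by the STRAIGHT-LINE homotopy `F(σ, t) = (1-σ)·L(t) + σ·C(t)`, and
this homotopy AVOIDS the Gaussian integers `ℤ + ℤi`: on each quarter of the parameter interval one
real coordinate of both `L(t)` and `C(t)` lies in one open unit interval (`(-1,0)` or `(0,1)`), hence
so does that coordinate of every convex combination, so `F(σ,t)` has a non-integral coordinate.

* `exists_square_circle_homotopy` — the statement consumed downstream (abc-iut cell, sub-DAG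
  [AbsTopIII] Cor 2.7 (b), piece F3a of the row «AbelianCoverOfPuncturedTorusExtends», holder
  abc-iut-L4-t8; spec `F3a-SPEC.md` sha16 5a3bb502038cb254): `∃ (L C : Path b b) (F : L.Homotopy C)`
  with `L` given on the four quarters by the four edge formulas (quarter time per edge), `C` the
  circle, and `∀ x, F x ∉ {m + n i}`.  Pushed down to the torus `ℂ/ℤ[i]` minus the origin, `L`
  becomes the commutator `αβα⁻¹β⁻¹` of the two lattice loops and `C` the small loop about the
  puncture (that transport is NOT done here).

Everything is proved; Mathlib only (`ContinuousMap.Homotopy.affine`, `Path.segment`, `Path.trans`).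

## References
* A. Hatcher, *Algebraic Topology*, CUP (2002), §1.2 p. 51. [HatcherAT2002]
* S. Mochizuki, *Topics in Absolute Anabelian Geometry III*, J. Math. Sci. Univ. Tokyo 22 (2015),
  Cor. 2.7 (b) p. 59 (where the punctured-torus covering argument is used). [MochizukiAbsTopIII2015]
-/

noncomputable section

namespace Literature.AlgebraicTopology.FundamentalGroup

open Complex

/-! ### Real bookkeeping: convex combinations and non-integrality -/

/-- A convex combination of two reals lying in an open interval lies in that interval. [folklore] -/
private theorem convexComb_mem_Ioo {σ a c lo hi : ℝ} (hσ0 : 0 ≤ σ) (hσ1 : σ ≤ 1)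
    (ha1 : lo < a) (ha2 : a < hi) (hc1 : lo < c) (hc2 : c < hi) :
    lo < (1 - σ) * a + σ * c ∧ (1 - σ) * a + σ * c < hi := by
  rcases eq_or_lt_of_le hσ1 with rfl | hlt
  · constructor <;> linarith
  · have h1 : 0 < 1 - σ := by linarith
    constructor <;> nlinarith [mul_pos h1 (sub_pos.2 ha1), mul_nonneg hσ0 (sub_pos.2 hc1).le,
      mul_pos h1 (sub_pos.2 ha2), mul_nonneg hσ0 (sub_pos.2 hc2).le]

/-- The real part of a point of the segment `[z, w]` is the corresponding convex combination of the
real parts. [folklore] -/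
private theorem re_lineMap (z w : ℂ) (σ : ℝ) :
    (AffineMap.lineMap z w σ).re = (1 - σ) * z.re + σ * w.re := by
  rw [AffineMap.lineMap_apply_module]
  simp [Complex.add_re]

/-- The imaginary part of a point of the segment `[z, w]` is the corresponding convex combination of
the imaginary parts. [folklore] -/
private theorem im_lineMap (z w : ℂ) (σ : ℝ) :
    (AffineMap.lineMap z w σ).im = (1 - σ) * z.im + σ * w.im := by
  rw [AffineMap.lineMap_apply_module]
  simp [Complex.add_im]

/-- A complex number whose real part lies strictly between two consecutive integers is not a Gaussian
integer. [folklore] -/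
private theorem not_mem_range_gauss_of_re {z : ℂ} (n : ℤ) (h1 : (n : ℝ) < z.re) (h2 : z.re < n + 1) :
    z ∉ Set.range (fun p : ℤ × ℤ ↦ ((p.1 : ℝ) : ℂ) + ((p.2 : ℝ) : ℂ) * Complex.I) := by
  rintro ⟨⟨m, k⟩, rfl⟩
  simp only [Complex.add_re, Complex.ofReal_re, Complex.mul_re, Complex.I_re, mul_zero,
    Complex.ofReal_im, Complex.I_im, mul_one, sub_self, add_zero] at h1 h2
  have h1' : n < m := by exact_mod_cast h1
  have h2' : m < n + 1 := by exact_mod_cast h2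
  omega

/-- A complex number whose imaginary part lies strictly between two consecutive integers is not a
Gaussian integer. [folklore] -/
private theorem not_mem_range_gauss_of_im {z : ℂ} (n : ℤ) (h1 : (n : ℝ) < z.im) (h2 : z.im < n + 1) :
    z ∉ Set.range (fun p : ℤ × ℤ ↦ ((p.1 : ℝ) : ℂ) + ((p.2 : ℝ) : ℂ) * Complex.I) := by
  rintro ⟨⟨m, k⟩, rfl⟩
  simp only [Complex.add_im, Complex.ofReal_im, Complex.mul_im, Complex.I_re, mul_zero,
    Complex.ofReal_re, Complex.I_im, mul_one, zero_add, add_zero] at h1 h2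
  have h1' : n < k := by exact_mod_cast h1
  have h2' : k < n + 1 := by exact_mod_cast h2
  omega

/-! ### Trigonometric bookkeeping: coordinates of `s·e^{iθ}` and signs on the four arcs -/

/-- `Re(s e^{iθ}) = s cos θ`. [folklore] -/
private theorem re_ofReal_mul_exp (s θ : ℝ) :
    ((s : ℂ) * Complex.exp ((θ : ℂ) * Complex.I)).re = s * Real.cos θ := by
  rw [Complex.re_ofReal_mul, Complex.exp_ofReal_mul_I_re]

/-- `Im(s e^{iθ}) = s sin θ`. [folklore] -/
private theorem im_ofReal_mul_exp (s θ : ℝ) :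
    ((s : ℂ) * Complex.exp ((θ : ℂ) * Complex.I)).im = s * Real.sin θ := by
  rw [Complex.im_ofReal_mul, Complex.exp_ofReal_mul_I_im]

/-- `sin θ < 0` on the arc `π < θ < 2π`. [folklore] -/
private theorem sin_neg_of_pi_lt {θ : ℝ} (h1 : Real.pi < θ) (h2 : θ < 2 * Real.pi) :
    Real.sin θ < 0 := by
  have h := Real.sin_neg_of_neg_of_neg_pi_lt (x := θ - 2 * Real.pi) (by linarith) (by linarith)
  rwa [Real.sin_sub_two_pi] at h

/-- `0 < cos θ` on the arc `3π/2 < θ < 5π/2`. [folklore] -/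
private theorem cos_pos_of_three_pi_div_two_lt {θ : ℝ} (h1 : 3 * Real.pi / 2 < θ)
    (h2 : θ < 5 * Real.pi / 2) : 0 < Real.cos θ := by
  have h := Real.cos_pos_of_mem_Ioo (x := θ - 2 * Real.pi) ⟨by linarith, by linarith⟩
  rwa [Real.cos_sub_two_pi] at h

/-- `0 < sin θ` on the arc `2π < θ < 3π`. [folklore] -/
private theorem sin_pos_of_two_pi_lt {θ : ℝ} (h1 : 2 * Real.pi < θ) (h2 : θ < 3 * Real.pi) :
    0 < Real.sin θ := by
  have h := Real.sin_pos_of_pos_of_lt_pi (x := θ - 2 * Real.pi) (by linarith) (by linarith)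
  rwa [Real.sin_sub_two_pi] at h

/-- `cos θ < 0` on the arc `5π/2 < θ < 7π/2`. [folklore] -/
private theorem cos_neg_of_five_pi_div_two_lt {θ : ℝ} (h1 : 5 * Real.pi / 2 < θ)
    (h2 : θ < 7 * Real.pi / 2) : Real.cos θ < 0 := by
  have h := Real.cos_neg_of_pi_div_two_lt_of_lt (x := θ - 2 * Real.pi) (by linarith) (by linarith)
  rwa [Real.cos_sub_two_pi] at h

/-- `s cos θ` and `s sin θ` lie in `(-1, 1)` when `0 < s < 1/2`. [folklore] -/
private theorem abs_lt_one_of_small {s x : ℝ} (hs : 0 < s) (hs' : s < 1 / 2) (hx : |x| ≤ 1) :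
    -1 < s * x ∧ s * x < 1 := by
  have h1 : |s * x| ≤ s := by
    rw [abs_mul, abs_of_pos hs]
    exact mul_le_of_le_one_right hs.le hx
  constructor <;> [linarith [neg_abs_le (s * x)]; linarith [le_abs_self (s * x)]]

/-! ### The theorem -/

/-- **The boundary of the unit square is homotopic, away from the Gaussian integers, to a small circle
about its interior lattice point.**  For `0 < s < 1/2` put `b = s·e^{5πi/4}` (`= -(s/√2)(1+i)`).  There
are loops `L, C : [0,1] → ℂ` at `b` and a homotopy `F` (rel. endpoints) from `L` to `C` such that:
`L` is the boundary of the unit square with lower-left corner `b`, traversed counterclockwise at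
quarter time per edge — `L(t) = b + 4t` (`t ≤ 1/4`), `b + 1 + (4t-1)i` (`1/4 ≤ t ≤ 1/2`),
`b + 1 + i - (4t-2)` (`1/2 ≤ t ≤ 3/4`), `b + i - (4t-3)i` (`3/4 ≤ t`); `C(t) = s·e^{i(5π/4 + 2πt)}` is
the circle of radius `s` about `0` through `b`; and NO point `F(σ, t)` is a Gaussian integer `m + ni`
(`F` is the straight-line homotopy; on each quarter one real coordinate of `L(t)` and of `C(t)` lies in
one open unit interval).  In the torus `ℂ/ℤ[i]` punctured at `0`, `L` is the commutator of the two
lattice loops and `C` the small loop about the puncture ("`π₁(T²) = ⟨a, b ∣ aba⁻¹b⁻¹⟩`", Hatcher §1.2).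
[cite: HatcherAT2002, §1.2 p.51] -/
theorem exists_square_circle_homotopy {s : ℝ} (hs : 0 < s) (hs' : s < 1 / 2) :
    ∃ (L C : Path ((s : ℂ) * Complex.exp (((5 * Real.pi / 4 : ℝ) : ℂ) * Complex.I))
        ((s : ℂ) * Complex.exp (((5 * Real.pi / 4 : ℝ) : ℂ) * Complex.I)))
      (F : L.Homotopy C),
      (∀ t : unitInterval, (t : ℝ) ≤ 1 / 4 →
          L t = (s : ℂ) * Complex.exp (((5 * Real.pi / 4 : ℝ) : ℂ) * Complex.I) +
            ((4 * (t : ℝ) : ℝ) : ℂ)) ∧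
      (∀ t : unitInterval, 1 / 4 ≤ (t : ℝ) → (t : ℝ) ≤ 1 / 2 →
          L t = (s : ℂ) * Complex.exp (((5 * Real.pi / 4 : ℝ) : ℂ) * Complex.I) + 1 +
            ((4 * (t : ℝ) - 1 : ℝ) : ℂ) * Complex.I) ∧
      (∀ t : unitInterval, 1 / 2 ≤ (t : ℝ) → (t : ℝ) ≤ 3 / 4 →
          L t = (s : ℂ) * Complex.exp (((5 * Real.pi / 4 : ℝ) : ℂ) * Complex.I) + 1 +
            Complex.I - ((4 * (t : ℝ) - 2 : ℝ) : ℂ)) ∧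
      (∀ t : unitInterval, 3 / 4 ≤ (t : ℝ) →
          L t = (s : ℂ) * Complex.exp (((5 * Real.pi / 4 : ℝ) : ℂ) * Complex.I) + Complex.I -
            ((4 * (t : ℝ) - 3 : ℝ) : ℂ) * Complex.I) ∧
      (∀ t : unitInterval,
          C t = (s : ℂ) *
            Complex.exp (((5 * Real.pi / 4 + 2 * Real.pi * (t : ℝ) : ℝ) : ℂ) * Complex.I)) ∧
      (∀ x : unitInterval × unitInterval,
          F x ∉ Set.range (fun p : ℤ × ℤ ↦ ((p.1 : ℝ) : ℂ) + ((p.2 : ℝ) : ℂ) * Complex.I)) := by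
  -- the base point and its coordinates
  set b : ℂ := (s : ℂ) * Complex.exp (((5 * Real.pi / 4 : ℝ) : ℂ) * Complex.I) with hb
  have hπ := Real.pi_pos
  have hbre : -1 < b.re ∧ b.re < 0 := by
    have hcos : Real.cos (5 * Real.pi / 4) < 0 :=
      Real.cos_neg_of_pi_div_two_lt_of_lt (by linarith) (by linarith)
    rw [hb, re_ofReal_mul_exp]
    exact ⟨(abs_lt_one_of_small hs hs' (Real.abs_cos_le_one _)).1, mul_neg_of_pos_of_neg hs hcos⟩
  have hbim : -1 < b.im ∧ b.im < 0 := by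
    have hsin : Real.sin (5 * Real.pi / 4) < 0 := sin_neg_of_pi_lt (by linarith) (by linarith)
    rw [hb, im_ofReal_mul_exp]
    exact ⟨(abs_lt_one_of_small hs hs' (Real.abs_sin_le_one _)).1, mul_neg_of_pos_of_neg hs hsin⟩
  -- the square loop: four segments, quarter time each
  let L : Path b b :=
    ((Path.segment b (b + 1)).trans (Path.segment (b + 1) (b + 1 + Complex.I))).trans
      ((Path.segment (b + 1 + Complex.I) (b + Complex.I)).trans (Path.segment (b + Complex.I) b))
  -- the circle
  let C : Path b b :=
    { toFun := fun t => (s : ℂ) *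
        Complex.exp (((5 * Real.pi / 4 + 2 * Real.pi * (t : ℝ) : ℝ) : ℂ) * Complex.I)
      continuous_toFun := by fun_prop
      source' := by
        simp only [Set.Icc.coe_zero, mul_zero, add_zero]
        exact hb.symm
      target' := by
        simp only [Set.Icc.coe_one, mul_one]
        have h : (((5 * Real.pi / 4 + 2 * Real.pi : ℝ) : ℂ) * Complex.I) =
            ((5 * Real.pi / 4 : ℝ) : ℂ) * Complex.I + 2 * Real.pi * Complex.I := by
          push_cast; ring
        rw [h, Complex.exp_add, Complex.exp_two_pi_mul_I, mul_one] }
  -- the four edge formulas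
  have hL1 : ∀ t : unitInterval, (t : ℝ) ≤ 1 / 4 → L t = b + ((4 * (t : ℝ) : ℝ) : ℂ) := by
    intro t ht
    have h2 : (t : ℝ) ≤ 1 / 2 := by linarith
    simp only [L, Path.trans_apply, dif_pos h2]
    have h4 : ((⟨2 * (t : ℝ), (unitInterval.mul_pos_mem_iff zero_lt_two).2 ⟨t.2.1, h2⟩⟩ :
        unitInterval) : ℝ) ≤ 1 / 2 := by
      show 2 * (t : ℝ) ≤ 1 / 2; linarith
    rw [dif_pos h4, Path.segment_apply, AffineMap.lineMap_apply_module']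
    simp only [Complex.real_smul]
    push_cast; ring
  have hL2 : ∀ t : unitInterval, 1 / 4 ≤ (t : ℝ) → (t : ℝ) ≤ 1 / 2 →
      L t = b + 1 + ((4 * (t : ℝ) - 1 : ℝ) : ℂ) * Complex.I := by
    intro t ht ht'
    simp only [L, Path.trans_apply, dif_pos ht']
    by_cases h4 : ((⟨2 * (t : ℝ), (unitInterval.mul_pos_mem_iff zero_lt_two).2 ⟨t.2.1, ht'⟩⟩ :
        unitInterval) : ℝ) ≤ 1 / 2
    · rw [dif_pos h4, Path.segment_apply, AffineMap.lineMap_apply_module']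
      have ht4 : (t : ℝ) = 1 / 4 := by
        have : 2 * (t : ℝ) ≤ 1 / 2 := h4
        linarith
      simp only [Complex.real_smul, ht4]
      push_cast; ring
    · rw [dif_neg h4, Path.segment_apply, AffineMap.lineMap_apply_module']
      simp only [Complex.real_smul]
      push_cast; ring
  have hL3 : ∀ t : unitInterval, 1 / 2 ≤ (t : ℝ) → (t : ℝ) ≤ 3 / 4 →
      L t = b + 1 + Complex.I - ((4 * (t : ℝ) - 2 : ℝ) : ℂ) := by
    intro t ht ht'
    simp only [L, Path.trans_apply]
    by_cases h2 : (t : ℝ) ≤ 1 / 2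
    · have ht2 : (t : ℝ) = 1 / 2 := le_antisymm h2 ht
      rw [dif_pos h2]
      have h4 : ¬ ((⟨2 * (t : ℝ), (unitInterval.mul_pos_mem_iff zero_lt_two).2 ⟨t.2.1, h2⟩⟩ :
          unitInterval) : ℝ) ≤ 1 / 2 := by
        show ¬ 2 * (t : ℝ) ≤ 1 / 2; linarith
      rw [dif_neg h4, Path.segment_apply, AffineMap.lineMap_apply_module']
      simp only [Complex.real_smul, ht2]
      push_cast; ring
    · rw [dif_neg h2]
      have h4 : ((⟨2 * (t : ℝ) - 1, unitInterval.two_mul_sub_one_mem_iff.2 ⟨(not_le.1 h2).le, t.2.2⟩⟩ :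
          unitInterval) : ℝ) ≤ 1 / 2 := by
        show 2 * (t : ℝ) - 1 ≤ 1 / 2; linarith
      rw [dif_pos h4, Path.segment_apply, AffineMap.lineMap_apply_module']
      simp only [Complex.real_smul]
      push_cast; ring
  have hL4 : ∀ t : unitInterval, 3 / 4 ≤ (t : ℝ) →
      L t = b + Complex.I - ((4 * (t : ℝ) - 3 : ℝ) : ℂ) * Complex.I := by
    intro t ht
    have h2 : ¬ (t : ℝ) ≤ 1 / 2 := by linarith
    simp only [L, Path.trans_apply, dif_neg h2]
    by_cases h4 : ((⟨2 * (t : ℝ) - 1, unitInterval.two_mul_sub_one_mem_iff.2 ⟨(not_le.1 h2).le, t.2.2⟩⟩ :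
        unitInterval) : ℝ) ≤ 1 / 2
    · rw [dif_pos h4, Path.segment_apply, AffineMap.lineMap_apply_module']
      have ht4 : (t : ℝ) = 3 / 4 := by
        have : 2 * (t : ℝ) - 1 ≤ 1 / 2 := h4
        linarith
      simp only [Complex.real_smul, ht4]
      push_cast; ring
    · rw [dif_neg h4, Path.segment_apply, AffineMap.lineMap_apply_module']
      simp only [Complex.real_smul]
      push_cast; ring
  have hC : ∀ t : unitInterval, C t = (s : ℂ) *
      Complex.exp (((5 * Real.pi / 4 + 2 * Real.pi * (t : ℝ) : ℝ) : ℂ) * Complex.I) := fun t => rfl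
  -- the straight-line homotopy
  let F : L.Homotopy C :=
    { toHomotopy := ContinuousMap.Homotopy.affine L.toContinuousMap C.toContinuousMap
      prop' := fun σ x hx => by
        change (AffineMap.lineMap (L x) (C x) (σ : ℝ) : ℂ) = L x
        simp only [Set.mem_insert_iff, Set.mem_singleton_iff] at hx
        rcases hx with rfl | rfl
        · rw [L.source, C.source, AffineMap.lineMap_same_apply]
        · rw [L.target, C.target, AffineMap.lineMap_same_apply] }
  have hF : ∀ x : unitInterval × unitInterval, F x = AffineMap.lineMap (L x.2) (C x.2) (x.1 : ℝ) :=
    fun x => rfl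
  refine ⟨L, C, F, hL1, hL2, hL3, hL4, hC, ?_⟩
  -- avoidance of the Gaussian integers, quarter by quarter
  intro x
  obtain ⟨σ, t⟩ := x
  have hσ0 : 0 ≤ (σ : ℝ) := σ.2.1
  have hσ1 : (σ : ℝ) ≤ 1 := σ.2.2
  have ht0 : 0 ≤ (t : ℝ) := t.2.1
  have ht1 : (t : ℝ) ≤ 1 := t.2.2
  rw [hF]
  change (AffineMap.lineMap (L t) (C t) (σ : ℝ) : ℂ) ∉ _
  have hCre : (C t).re = s * Real.cos (5 * Real.pi / 4 + 2 * Real.pi * (t : ℝ)) := by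
    rw [hC, re_ofReal_mul_exp]
  have hCim : (C t).im = s * Real.sin (5 * Real.pi / 4 + 2 * Real.pi * (t : ℝ)) := by
    rw [hC, im_ofReal_mul_exp]
  rcases le_or_gt (t : ℝ) (1 / 4) with h1 | h1
  · -- first quarter: imaginary parts in (-1, 0)
    have hLt : -1 < (L t).im ∧ (L t).im < 0 := by
      rw [hL1 t h1]; simpa using hbim
    have hsin : Real.sin (5 * Real.pi / 4 + 2 * Real.pi * (t : ℝ)) < 0 :=
      sin_neg_of_pi_lt (by nlinarith) (by nlinarith)
    have hCt : -1 < (C t).im ∧ (C t).im < 0 := by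
      rw [hCim]
      exact ⟨(abs_lt_one_of_small hs hs' (Real.abs_sin_le_one _)).1, mul_neg_of_pos_of_neg hs hsin⟩
    have key := convexComb_mem_Ioo hσ0 hσ1 hLt.1 hLt.2 hCt.1 hCt.2
    refine not_mem_range_gauss_of_im (-1) ?_ ?_ <;> rw [im_lineMap] <;> push_cast <;>
      linarith [key.1, key.2]
  rcases le_or_gt (t : ℝ) (1 / 2) with h2 | h2
  · -- second quarter: real parts in (0, 1)
    have hLt : 0 < (L t).re ∧ (L t).re < 1 := by
      rw [hL2 t h1.le h2]
      simp only [Complex.add_re, Complex.one_re, Complex.mul_re, Complex.ofReal_re, Complex.I_re,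
        mul_zero, Complex.ofReal_im, Complex.I_im, mul_one, sub_self, add_zero]
      constructor <;> linarith [hbre.1, hbre.2]
    have hcos : 0 < Real.cos (5 * Real.pi / 4 + 2 * Real.pi * (t : ℝ)) :=
      cos_pos_of_three_pi_div_two_lt (by nlinarith) (by nlinarith)
    have hCt : 0 < (C t).re ∧ (C t).re < 1 := by
      rw [hCre]
      exact ⟨mul_pos hs hcos, (abs_lt_one_of_small hs hs' (Real.abs_cos_le_one _)).2⟩
    have key := convexComb_mem_Ioo hσ0 hσ1 hLt.1 hLt.2 hCt.1 hCt.2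
    refine not_mem_range_gauss_of_re 0 ?_ ?_ <;> rw [re_lineMap] <;> push_cast <;>
      linarith [key.1, key.2]
  rcases le_or_gt (t : ℝ) (3 / 4) with h3 | h3
  · -- third quarter: imaginary parts in (0, 1)
    have hLt : 0 < (L t).im ∧ (L t).im < 1 := by
      rw [hL3 t h2.le h3]
      simp only [Complex.sub_im, Complex.add_im, Complex.one_im, Complex.I_im, Complex.ofReal_im,
        add_zero, sub_zero]
      constructor <;> linarith [hbim.1, hbim.2]
    have hsin : 0 < Real.sin (5 * Real.pi / 4 + 2 * Real.pi * (t : ℝ)) :=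
      sin_pos_of_two_pi_lt (by nlinarith) (by nlinarith)
    have hCt : 0 < (C t).im ∧ (C t).im < 1 := by
      rw [hCim]
      exact ⟨mul_pos hs hsin, (abs_lt_one_of_small hs hs' (Real.abs_sin_le_one _)).2⟩
    have key := convexComb_mem_Ioo hσ0 hσ1 hLt.1 hLt.2 hCt.1 hCt.2
    refine not_mem_range_gauss_of_im 0 ?_ ?_ <;> rw [im_lineMap] <;> push_cast <;>
      linarith [key.1, key.2]
  · -- fourth quarter: real parts in (-1, 0)
    have hLt : -1 < (L t).re ∧ (L t).re < 0 := by
      rw [hL4 t h3.le]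
      simp only [Complex.sub_re, Complex.add_re, Complex.I_re, Complex.mul_re, Complex.ofReal_re,
        Complex.ofReal_im, Complex.I_im, mul_zero, mul_one, sub_self, add_zero, sub_zero]
      exact hbre
    have hcos : Real.cos (5 * Real.pi / 4 + 2 * Real.pi * (t : ℝ)) < 0 :=
      cos_neg_of_five_pi_div_two_lt (by nlinarith) (by nlinarith)
    have hCt : -1 < (C t).re ∧ (C t).re < 0 := by
      rw [hCre]
      exact ⟨(abs_lt_one_of_small hs hs' (Real.abs_cos_le_one _)).1, mul_neg_of_pos_of_neg hs hcos⟩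
    have key := convexComb_mem_Ioo hσ0 hσ1 hLt.1 hLt.2 hCt.1 hCt.2
    refine not_mem_range_gauss_of_re (-1) ?_ ?_ <;> rw [re_lineMap] <;> push_cast <;>
      linarith [key.1, key.2]

end Literature.AlgebraicTopology.FundamentalGroup

end
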